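/-
Copyright (c) 2026. All rights reserved.
Released under Apache 2.0 license as described in the file LICENSE.
Authors: abc-iut cell, prover seat abc-iut-w5-d144 (gen 6; row «COR510iv-SB′», brick B), after abc-iut-L4-t3's
`LogFrobeniusGenuineIotaOver.lean` (the unrestricted settings), over abc-iut-w5-d053's sub-model constructor
`nonarchGenuineMonoAnSub` (`AbsTopIII/MLFGaloisModelOpenAug.lean`).
-/
import Literature.AnabelianGeometry.AbsoluteAnabelian.LogFrobeniusIotaOver
import Literature.AnabelianGeometry.AbsoluteAnabelian.LogFrobeniusLamOverLink
import Literature.AnabelianGeometry.AbsoluteAnabelian.LogFrobeniusMonoGenuineProp58viiPfOpen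
import HarnessLib

/-!
# [AbsTopIII] Def 5.4 (iv)/(vii): the `ι⊞_{v,ε}` lie over `Th•[Z]` (`IotaOver`) at the SUB-MODEL settings — in particular at
# the genuine open-augmentation carrier `nonarchGenuineMonoAnPfOpen` of Cor 5.10 (iv)(b)(c)

S. Mochizuki, *Topics in absolute anabelian geometry III: global reconstruction algorithms*,
J. Math. Sci. Univ. Tokyo 22 (2015) 939–1156 [MochizukiAbsTopIII2015]; manuscript `paper:url-5493eb38cbb7`: Def 5.4 (iv)
p. 127 l. 56–65 ("natural functors `λ⊞_{v,ν} …` that 'lie over' `Th•[Z]`"), (vii) p. 128 l. 83–101 ("the arrow in the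
diagram of (iii) … corresponding to `ε` determines a natural transformation `ι⊞_{v,ε}`"), Def 5.4 (ii) p. 125 ("`log•_{T,T}`
'lies over' `Th•`").

PROOF-ONLY companion of abc-iut-L4-t3's interface add-on `LogFrobeniusSetting.IotaOver` (`LogFrobeniusIotaOver.lean`: «the
`ι⊞_{v,ε}`, pushed down along `𝒩⊞_v → 𝒩_v → Th•[Z]`, are the composites of the structure isomorphisms» — a hypothesis
schema NOT recorded by the frozen interface) and of its genuine instances `nonarchGenuine_iotaOver` /
`nonarchGenuineMono_iotaOver` (`LogFrobeniusGenuineIotaOver.lean`).  Row «COR510iv-SB′» (abc-iut-L4-lead m127/m130): the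
closer of Cor 5.10 (iv)(b)'s compatibility sentence at the genuine open-augmentation carrier needs `IotaOver` THERE (spec
`COR510iv-SBprime-CLOSER-SPEC.md`, hypothesis (ιover⊞): by uniqueness of lifts through the fully faithful structure functor
`An⊢ ⥲ ℰ⊢`, the telecore family and the whiskered observable homotopies agree exactly when the `ι⊞` lie over the base).

* `nonarchGenuineMonoAnSub_iotaOver` — **`IotaOver` HOLDS at every sub-model setting** `nonarchGenuineMonoAnSub p P ψ`
  (abc-iut-w5-d053): its `ι⊞_{v,ε} = (𝟙, ι_ε ∘ P.ι)` have identity base components and every structure isomorphism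
  (`lamOver`, `logOver = Iso.refl`) is an identity on the base — the same two-line computation as at the unrestricted
  setting, for every object property `P` of the MLF model and every container family `ψ`;
* `nonarchGenuineMonoAnPfOpen_iotaOver` — in particular at `nonarchGenuineMonoAnPfOpen p Vmod isArc`
  (`P = TFModel.IsOpenAug`, `ψ = MLFClosure.ψMonoPf`), the carrier of abc-iut-f-101's `cor510MonoTelecorePinned_genuineOpen`;
* (appended) `nonarchGenuineMonoAnSub_lamOverLink`, `nonarchGenuineMonoAnPfOpen_lamOverLink` — abc-iut-L4-t3's companion
  add-on `LamOverLink` (the Cor 5.5 p. 130 proviso at the level of over-structures) at the same settings.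

MODEL-LEVEL (one nonarchimedean place type; archimedean rows of these settings are placeholders, where the clause holds
by identities); refereed pre-IUT material; nothing here bears on [IUTchIII] Cor. 3.12; no side taken; typed ≠ proved.
-/

universe u

open CategoryTheory

namespace Literature.AnabelianGeometry.AbsoluteAnabelian

namespace LogFrobeniusSetting

open AbsTopIII

variable (p : ℕ) [Fact p.Prime] (P : ObjectProperty (TFModel p))
  (ψ : (b : Bool) → LogVertex b → (MLFClosure.AnMono ⥤ MLFClosure.MonoBase × TSObj))
  (Vmod : Type 1) (isArc : Vmod → Bool)

/-- Per-Boolean form: `ι⊞_{v,ε} = (𝟙, ι_ε ∘ P.ι)` at a nonarchimedean place, the identity at an archimedean place of THIS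
setting (placeholder); its image under the first projection `𝒩_v = 𝒳 × 𝒞_TS → 𝒳 = ℰ•` is, at each object, a composite
of identities of the underlying object of the sub-model, as is the composite of the (identity) structure isomorphisms.
[cite: MochizukiAbsTopIII2015, Def 5.4 (vii) p. 128] -/
private theorem nonarchGenuineMonoAnSub_iotaOver_aux (b : Bool) {ν₁ ν₂ : LogVertex b} (ε : LogEdge b ν₁ ν₂) :
    Functor.whiskerRight (nonarchIotaSub p P b ε)
        (𝟭 (Up (P.FullSubcategory × TSObj)) ⋙ Up.liftF (CategoryTheory.Prod.fst P.FullSubcategory TSObj)) =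
      (Functor.associator _ _ _ ≪≫ Functor.isoWhiskerLeft _ (nonarchLamOverSub p P b ν₁) ≪≫
          (nonarchGenuineMonoAnSub p P ψ Vmod isArc).twistOver ν₁.isPostLog).hom ≫
        (nonarchLamOverSub p P b ν₂).inv := by
  ext X₀
  cases b
  · -- nonarchimedean place: `(𝟙, ι_ε ∘ P.ι)` for the five edges of `Γ⃗^⋉_non`
    cases ν₁ <;>
    · change (𝟙 X₀.down.obj ≫ 𝟙 X₀.down.obj : X₀.down.obj ⟶ X₀.down.obj) =
          (𝟙 X₀.down.obj ≫ (𝟙 X₀.down.obj ≫ 𝟙 X₀.down.obj)) ≫ 𝟙 X₀.down.obj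
      simp
  · -- archimedean place of THIS setting: placeholder identities
    cases ν₁ <;>
    · change (𝟙 X₀.down.obj ≫ 𝟙 X₀.down.obj : X₀.down.obj ⟶ X₀.down.obj) =
          (𝟙 X₀.down.obj ≫ (𝟙 X₀.down.obj ≫ 𝟙 X₀.down.obj)) ≫ 𝟙 X₀.down.obj
      simp

/-- **`IotaOver` HOLDS at every sub-model setting `nonarchGenuineMonoAnSub p P ψ`** (abc-iut-w5-d053's restriction of
abc-iut-w4-d095's genuine nonarchimedean rows to a full subcategory `P` of the MLF model, any mono-analytic container
family `ψ`): the `ι⊞_{v,ε}` lie over `Th•[Z] = 𝒳` — their base components are identities.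
[cite: MochizukiAbsTopIII2015, Def 5.4 (vii) p. 128] -/
theorem nonarchGenuineMonoAnSub_iotaOver : (nonarchGenuineMonoAnSub p P ψ Vmod isArc).IotaOver :=
  fun v _ _ ε => nonarchGenuineMonoAnSub_iotaOver_aux p P ψ Vmod isArc (isArc v) ε

/-- ★ **`IotaOver` HOLDS at the genuine open-augmentation carrier** `nonarchGenuineMonoAnPfOpen p Vmod isArc`
(`= nonarchGenuineMonoAnSub p TFModel.IsOpenAug MLFClosure.ψMonoPf`; abc-iut-f-101's `genuineOpen p Vmod` is the case
`isArc := fun _ => false`) — hypothesis (ιover⊞) of the Cor 5.10 (iv)(b) compatibility closer.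
[cite: MochizukiAbsTopIII2015, Def 5.4 (vii) p. 128] -/
theorem nonarchGenuineMonoAnPfOpen_iotaOver : (nonarchGenuineMonoAnPfOpen p Vmod isArc).IotaOver :=
  nonarchGenuineMonoAnSub_iotaOver p (TFModel.IsOpenAug (p := p)) MLFClosure.ψMonoPf Vmod isArc

/-- Consequence BY NAME (abc-iut-L4-t3's `IotaOver.isIso_toE_forget_iota`): over `Th•[Z]` every `ι⊞_{v,ε}` of the genuine
open-augmentation carrier is an isomorphism (abc-iut-f-102's per-place necessary condition for Cor 5.5 (i)+(iii)).
[cite: MochizukiAbsTopIII2015, Def 5.4 (vii) p. 128] -/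
theorem nonarchGenuineMonoAnPfOpen_isIso_toE_forget_iota (v : Vmod) {ν₁ ν₂ : LogVertex (isArc v)}
    (ε : LogEdge (isArc v) ν₁ ν₂) (X₀ : (nonarchGenuineMonoAnPfOpen p Vmod isArc).X) :
    IsIso (((nonarchGenuineMonoAnPfOpen p Vmod isArc).toE v).map
      (((nonarchGenuineMonoAnPfOpen p Vmod isArc).forget v).map
        (((nonarchGenuineMonoAnPfOpen p Vmod isArc).iota v ε).app X₀))) :=
  (nonarchGenuineMonoAnPfOpen_iotaOver p Vmod isArc).isIso_toE_forget_iota v ε X₀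

/-! ## Appended (abc-iut-w5-d144 gen 6, same evening): the proviso's over-structure link `LamOverLink` at the same settings -/

/-- **`LamOverLink` HOLDS at every sub-model setting `nonarchGenuineMonoAnSub p P ψ`** (abc-iut-L4-t3's add-on, Cor 5.5 p. 130
proviso completed to the over-structure: `HEq (lamOver v space-link) (lamOver v post-log)`): on the sub-model the two
"`λ⊞` lies over" isomorphisms are the SAME identity (`nonarchLamOverSub` does not read the vertex) — the twin of
abc-iut-L4-t3's `nonarchGenuineMono_lamOverLink`. [cite: MochizukiAbsTopIII2015, Cor 5.5 p. 130] -/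
theorem nonarchGenuineMonoAnSub_lamOverLink : (nonarchGenuineMonoAnSub p P ψ Vmod isArc).LamOverLink := by
  intro v
  change HEq (nonarchLamOverSub p P (isArc v) (LogVertex.spaceLink (isArc v)))
    (nonarchLamOverSub p P (isArc v) (LogVertex.postLog (isArc v)))
  generalize isArc v = b
  cases b <;> exact HEq.rfl

/-- ★ **`LamOverLink` HOLDS at the genuine open-augmentation carrier** `nonarchGenuineMonoAnPfOpen p Vmod isArc` — with
`nonarchGenuineMonoAnPfOpen_iotaOver` the pair of interface add-ons (`IotaOver`, `LamOverLink`) under which abc-iut-f-102's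
THEOREM B / abc-iut-L4-t3's `IotaOver.toE_map_iota_heq_spaceLink` apply at the carrier.
[cite: MochizukiAbsTopIII2015, Cor 5.5 p. 130] -/
theorem nonarchGenuineMonoAnPfOpen_lamOverLink : (nonarchGenuineMonoAnPfOpen p Vmod isArc).LamOverLink :=
  nonarchGenuineMonoAnSub_lamOverLink p (TFModel.IsOpenAug (p := p)) MLFClosure.ψMonoPf Vmod isArc

/-- The pair of add-ons at the carrier, bundled. [cite: MochizukiAbsTopIII2015, Def 5.4 (vii) p. 128] -/
theorem nonarchGenuineMonoAnPfOpen_iotaOver_and_lamOverLink :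
    (nonarchGenuineMonoAnPfOpen p Vmod isArc).IotaOver ∧ (nonarchGenuineMonoAnPfOpen p Vmod isArc).LamOverLink :=
  ⟨nonarchGenuineMonoAnPfOpen_iotaOver p Vmod isArc, nonarchGenuineMonoAnPfOpen_lamOverLink p Vmod isArc⟩

end LogFrobeniusSetting

end Literature.AnabelianGeometry.AbsoluteAnabelian
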